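import Summits.QuantumFields.BalabanUV.Beta.FP.NestedStepLawOneShotJetsGraded

/-!
# `BalabanUV.Beta.FP.GradedCoarseParity` — road «FP» for binder row D1, ROUTE T, option (δ) «LIFT ∕ GRADED» (R-FP-54′):
# **THE GRADED PARITIES PROPAGATE THROUGH THE STEP** — the coarse jets of the graded door are again (symmetric, ANTISYMMETRIC, symmetric),
# so the graded one-shot step law ITERATES level by level with its parity slots fed by theorems

WHAT.  The graded door `NestedStepLawOneShotJetsGraded.secondVar_oneShot_nestedStepLaw_jets_graded` (p323821) asks for the parities
`𝔎₀ᵀ = 𝔎₀`, `𝔎₁ᵀ = −𝔎₁`, `𝔎₂ᵀ = 𝔎₂` of the composite form jets and DELIVERS, as the coarse system's form jets, the words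
`E₀ := S.toBlocks₁₁ + G₀`, `E₁ := ((L·H₁ − S·B)·I + L·Bᵀ·S).toBlocks₁₁ + G₁` and `E₂ := (graded second word).toBlocks₁₁ + G₂`
(`Γ I L S` = `flucCov ∕ minOp ∕ minOpL ∕ effForm` of the fine sliced system `(H₀, [Q₁₀; τ₁])`, `B = [Q₁₁; 0]`).  To feed the coarse system into
the door AT THE NEXT LEVEL (the self-similar induction «one-shot (j, m+1) = one-step (j) + one-shot (j+1, m)») its jets must satisfy the same
three parities.  THEY DO, by [folklore] transpose algebra: for a SYMMETRIC fine form `H₀ᵀ = H₀` the bordered inverse is symmetric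
(`CompositionSingular.minOpL_eq_transpose`: `L = Iᵀ`, `Γᵀ = Γ`, `Sᵀ = S`), and then `E₀ᵀ = E₀`, **`E₁ᵀ = −E₁`** (given `H₁ᵀ = −H₁`, `G₁ᵀ = −G₁`;
ANY `B`), `E₂ᵀ = E₂` (given `H₂ᵀ = H₂`, `G₂ᵀ = G₂`; ANY `B`, `Q₁₂`).  REMARK (located, F-FP-18-2 one level up): the UN-graded first word
`(L·H₁ − S·B)·I − L·Bᵀ·S` is `IᵀH₁I − (Y + Yᵀ)` with `Y := S·B·I` — NOT antisymmetric unless `Y + Yᵀ = 0`; the graded one is `IᵀH₁I − Y + Yᵀ`,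
antisymmetric for every `B`: the (δ) reading is the one under which the coarse first-order form table CAN be antisymmetric, as the level-`(j+1)`
table of record is (`hessFFAt_antisymm`).  §1 generic words; §2 at the door's namings (`hΓ hI hL hS` + `H₀ᵀ = H₀`).
[folklore]; no `def`, no `def … : Prop`, nothing cited, 0 sorry.  Nothing of the dictionary asserted.

HONEST DEPENDENCY (page 1, mandatory): continuum YM on T⁴ ⇐ BetaPertH ∧ nine spine estimates (0/9 proved); BetaPertH ⇐ (D1) ∧ (D4) ∧ CAP+tail;
G-an2-4 gates asym, D1 and NE2/3/4.  HONEST FRAMING (cell contract, verbatim): «discharging `BetaPertH` makes Bałaban's UV stability UNCONDITIONAL —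
a real constructive-QFT result; it is NOT the continuum limit and NOT the Clay problem.»  ABSOLUTE RULE (cell charter, verbatim): «No internally-minted
statement may enter as a cited fact. Every hypothesis is either kernel-proved in this package or a verbatim quotation of a PUBLISHED theorem with page
reference. The manuscript(s) under audit are NOT citable for their own disputed steps — they are the thing under adjudication; programme-internal
(2001/route/tribunal) claims are never citable.»  0 estimates; 0∕4 row-D1 binders; NOT (T-ID), NOT SDF, NOT D1, NOT BetaPertH, NOT continuum, NOT Clay.
Road «FP» OWNER, b2b-balaban-beta-d1-p3 gen 19, 2026-08-22.  No existing file touched.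
-/

noncomputable section

namespace Summit.QuantumFields.BalabanUV.Beta.FP.GradedCoarseParity

open Matrix
open Literature.MathematicalPhysics.QuantumFieldTheory.Balaban1983to89.Beta.Composition (kkt)
open Literature.MathematicalPhysics.QuantumFieldTheory.Balaban1983to89.Beta.CompositionSingular (effForm flucCov minOp minOpL minOpL_eq_transpose)

/-! ## §1 Generic words -/

section Generic

variable {ν μ ρ : Type*}

/-- [folklore] transpose commutes with the `(1,1)` block. -/
theorem toBlocks₁₁_transpose (M : Matrix (μ ⊕ ρ) (μ ⊕ ρ) ℝ) : (M.toBlocks₁₁)ᵀ = (Mᵀ).toBlocks₁₁ := by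
  ext i j; rfl

/-- [folklore] negation commutes with the `(1,1)` block. -/
theorem toBlocks₁₁_neg (M : Matrix (μ ⊕ ρ) (μ ⊕ ρ) ℝ) : (-M).toBlocks₁₁ = -M.toBlocks₁₁ := by
  ext i j; rfl

/-- [folklore] **ORDER 0**: `(S₁₁ + G₀)ᵀ = S₁₁ + G₀` for symmetric `S`, `G₀`. -/
theorem coarseJet₀_transpose {S : Matrix (μ ⊕ ρ) (μ ⊕ ρ) ℝ} {G₀ : Matrix μ μ ℝ} (hS : Sᵀ = S) (hG₀ : G₀ᵀ = G₀) :
    (S.toBlocks₁₁ + G₀)ᵀ = S.toBlocks₁₁ + G₀ := by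
  rw [transpose_add, toBlocks₁₁_transpose, hS, hG₀]

variable [Fintype ν] [Fintype μ] [Fintype ρ]

/-- [folklore] **ORDER 1, THE GRADED WORD IS ANTISYMMETRIC**: with `L = Iᵀ`, `Sᵀ = S`, `H₁ᵀ = −H₁` (ANY `B`),
`((L·H₁ − S·B)·I + L·Bᵀ·S)ᵀ = −((L·H₁ − S·B)·I + L·Bᵀ·S)`. -/
theorem gradedWord₁_transpose (I : Matrix ν (μ ⊕ ρ) ℝ) {L : Matrix (μ ⊕ ρ) ν ℝ} {S : Matrix (μ ⊕ ρ) (μ ⊕ ρ) ℝ} {H₁ : Matrix ν ν ℝ}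
    (B : Matrix (μ ⊕ ρ) ν ℝ) (hL : L = Iᵀ) (hS : Sᵀ = S) (hH₁ : H₁ᵀ = -H₁) :
    ((L * H₁ - S * B) * I + L * Bᵀ * S)ᵀ = -((L * H₁ - S * B) * I + L * Bᵀ * S) := by
  subst hL
  simp only [transpose_add, transpose_sub, transpose_mul, transpose_transpose, hS, hH₁, Matrix.mul_neg, Matrix.neg_mul, Matrix.sub_mul,
    Matrix.mul_assoc, neg_add_rev, neg_sub]
  abel

/-- [folklore] **ORDER 1 AT THE COARSE FORM JET**: `(((L·H₁ − S·B)·I + L·Bᵀ·S)₁₁ + G₁)ᵀ = −(… + G₁)` (`G₁ᵀ = −G₁`). -/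
theorem coarseJet₁_transpose (I : Matrix ν (μ ⊕ ρ) ℝ) {L : Matrix (μ ⊕ ρ) ν ℝ} {S : Matrix (μ ⊕ ρ) (μ ⊕ ρ) ℝ} {H₁ : Matrix ν ν ℝ}
    (B : Matrix (μ ⊕ ρ) ν ℝ) {G₁ : Matrix μ μ ℝ} (hL : L = Iᵀ) (hS : Sᵀ = S) (hH₁ : H₁ᵀ = -H₁) (hG₁ : G₁ᵀ = -G₁) :
    (((L * H₁ - S * B) * I + L * Bᵀ * S).toBlocks₁₁ + G₁)ᵀ = -(((L * H₁ - S * B) * I + L * Bᵀ * S).toBlocks₁₁ + G₁) := by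
  rw [transpose_add, toBlocks₁₁_transpose, gradedWord₁_transpose I B hL hS hH₁, hG₁, toBlocks₁₁_neg, neg_add]

/-- [folklore] **ORDER 2, THE GRADED SECOND WORD IS SYMMETRIC**: with `L = Iᵀ`, `Γᵀ = Γ`, `Sᵀ = S`, `H₁ᵀ = −H₁`, `H₂ᵀ = H₂` (ANY `B`, `Q`), the
door's graded coarse second word is symmetric. -/
theorem gradedWord₂_transpose (I : Matrix ν (μ ⊕ ρ) ℝ) {L : Matrix (μ ⊕ ρ) ν ℝ} {Γ : Matrix ν ν ℝ} {S : Matrix (μ ⊕ ρ) (μ ⊕ ρ) ℝ}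
    {H₁ H₂ : Matrix ν ν ℝ} (B Q : Matrix (μ ⊕ ρ) ν ℝ) (hL : L = Iᵀ) (hΓ : Γᵀ = Γ) (hS : Sᵀ = S) (hH₁ : H₁ᵀ = -H₁) (hH₂ : H₂ᵀ = H₂) :
    ((((-((L * H₁ - S * B) * Γ - L * Bᵀ * L) * H₁ + L * H₂ - (((L * H₁ - S * B) * I + L * Bᵀ * S) * B + S * Q)) * I + (L * H₁ - S * B) * (-((Γ * H₁ + I * B) * I + Γ * Bᵀ * S))) - ((-((L * H₁ - S * B) * Γ - L * Bᵀ * L) * (-Bᵀ) + L * (Q)ᵀ) * S + L * (-Bᵀ) * ((L * H₁ - S * B) * I + L * Bᵀ * S))))ᵀ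
      = (((-((L * H₁ - S * B) * Γ - L * Bᵀ * L) * H₁ + L * H₂ - (((L * H₁ - S * B) * I + L * Bᵀ * S) * B + S * Q)) * I + (L * H₁ - S * B) * (-((Γ * H₁ + I * B) * I + Γ * Bᵀ * S))) - ((-((L * H₁ - S * B) * Γ - L * Bᵀ * L) * (-Bᵀ) + L * (Q)ᵀ) * S + L * (-Bᵀ) * ((L * H₁ - S * B) * I + L * Bᵀ * S))) := by
  subst hL
  simp only [transpose_add, transpose_sub, transpose_neg, transpose_mul, transpose_transpose, hΓ, hS, hH₁, hH₂, Matrix.mul_neg, Matrix.neg_mul,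
    Matrix.sub_mul, Matrix.mul_sub, Matrix.add_mul, Matrix.mul_add, Matrix.mul_assoc, neg_add_rev, neg_sub, neg_neg, sub_neg_eq_add]
  abel

/-- [folklore] **ORDER 2 AT THE COARSE FORM JET**: the door's coarse second jet word, with `[Q₁₂; 0]` for `Q`, plus `G₂`, is symmetric. -/
theorem coarseJet₂_transpose (I : Matrix ν (μ ⊕ ρ) ℝ) {L : Matrix (μ ⊕ ρ) ν ℝ} {Γ : Matrix ν ν ℝ} {S : Matrix (μ ⊕ ρ) (μ ⊕ ρ) ℝ}
    {H₁ H₂ : Matrix ν ν ℝ} (B Q : Matrix (μ ⊕ ρ) ν ℝ) {G₂ : Matrix μ μ ℝ}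
    (hL : L = Iᵀ) (hΓ : Γᵀ = Γ) (hS : Sᵀ = S) (hH₁ : H₁ᵀ = -H₁) (hH₂ : H₂ᵀ = H₂) (hG₂ : G₂ᵀ = G₂) :
    (((((-((L * H₁ - S * B) * Γ - L * Bᵀ * L) * H₁ + L * H₂ - (((L * H₁ - S * B) * I + L * Bᵀ * S) * B + S * Q)) * I + (L * H₁ - S * B) * (-((Γ * H₁ + I * B) * I + Γ * Bᵀ * S))) - ((-((L * H₁ - S * B) * Γ - L * Bᵀ * L) * (-Bᵀ) + L * (Q)ᵀ) * S + L * (-Bᵀ) * ((L * H₁ - S * B) * I + L * Bᵀ * S)))).toBlocks₁₁ + G₂)ᵀ = ((((-((L * H₁ - S * B) * Γ - L * Bᵀ * L) * H₁ + L * H₂ - (((L * H₁ - S * B) * I + L * Bᵀ * S) * B + S * Q)) * I + (L * H₁ - S * B) * (-((Γ * H₁ + I * B) * I + Γ * Bᵀ * S))) - ((-((L * H₁ - S * B) * Γ - L * Bᵀ * L) * (-Bᵀ) + L * (Q)ᵀ) * S + L * (-Bᵀ) * ((L * H₁ - S * B) * I + L * Bᵀ * S)))).toBlocks₁₁ + G₂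 := by
  rw [transpose_add, toBlocks₁₁_transpose, gradedWord₂_transpose I B Q hL hΓ hS hH₁ hH₂, hG₂]

end Generic

/-! ## §2 At the door's namings: the fine form is symmetric ⇒ the coarse jets carry the graded parities -/

section Namings

variable {ν μ ρ : Type*} [Fintype ν] [Fintype μ] [Fintype ρ] [DecidableEq ν] [DecidableEq μ] [DecidableEq ρ]

/-- [folklore] **THE GRADED PARITIES PROPAGATE THROUGH THE STEP.**  With the door's namings `hΓ hI hL hS` of the fine sliced system
`(H₀, [Q₁₀; τ₁])`, a SYMMETRIC fine form `H₀ᵀ = H₀`, an antisymmetric first form jet `H₁ᵀ = −H₁`, a symmetric second one `H₂ᵀ = H₂`, and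
constraint-metric jets with `G₀ᵀ = G₀`, `G₁ᵀ = −G₁`, `G₂ᵀ = G₂`: the three COARSE form jets of
`secondVar_oneShot_nestedStepLaw_jets_graded` (its conclusion's words VERBATIM, any `B`, any `Q₁₂`) are symmetric, ANTISYMMETRIC, symmetric —
exactly the parity slots the door asks for one level up. -/
theorem coarseJets_parity_of_namings (H₀ H₁ H₂ : Matrix ν ν ℝ) (Q₁₀ : Matrix μ ν ℝ) (τ₁ : Matrix ρ ν ℝ) (B Q : Matrix (μ ⊕ ρ) ν ℝ)
    (G₀ G₁ G₂ : Matrix μ μ ℝ) {Γ : Matrix ν ν ℝ} {I : Matrix ν (μ ⊕ ρ) ℝ} {L : Matrix (μ ⊕ ρ) ν ℝ} {S : Matrix (μ ⊕ ρ) (μ ⊕ ρ) ℝ}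
    (hΓ : flucCov H₀ (fromRows Q₁₀ τ₁) = Γ) (hI : minOp H₀ (fromRows Q₁₀ τ₁) = I) (hL : minOpL H₀ (fromRows Q₁₀ τ₁) = L) (hS : effForm H₀ (fromRows Q₁₀ τ₁) = S)
    (hH₀ : H₀ᵀ = H₀) (hH₁ : H₁ᵀ = -H₁) (hH₂ : H₂ᵀ = H₂) (hG₀ : G₀ᵀ = G₀) (hG₁ : G₁ᵀ = -G₁) (hG₂ : G₂ᵀ = G₂) :
    (S.toBlocks₁₁ + G₀)ᵀ = S.toBlocks₁₁ + G₀
    ∧ (((L * H₁ - S * B) * I + L * Bᵀ * S).toBlocks₁₁ + G₁)ᵀ = -(((L * H₁ - S * B) * I + L * Bᵀ * S).toBlocks₁₁ + G₁)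
    ∧ (((((-((L * H₁ - S * B) * Γ - L * Bᵀ * L) * H₁ + L * H₂ - (((L * H₁ - S * B) * I + L * Bᵀ * S) * B + S * Q)) * I + (L * H₁ - S * B) * (-((Γ * H₁ + I * B) * I + Γ * Bᵀ * S))) - ((-((L * H₁ - S * B) * Γ - L * Bᵀ * L) * (-Bᵀ) + L * (Q)ᵀ) * S + L * (-Bᵀ) * ((L * H₁ - S * B) * I + L * Bᵀ * S)))).toBlocks₁₁ + G₂)ᵀ = ((((-((L * H₁ - S * B) * Γ - L * Bᵀ * L) * H₁ + L * H₂ - (((L * H₁ - S * B) * I + L * Bᵀ * S) * B + S * Q)) * I + (L * H₁ - S * B) * (-((Γ * H₁ + I * B) * I + Γ * Bᵀ * S))) - ((-((L * H₁ - S * B) * Γ - L * Bᵀ * L) * (-Bᵀ) + L * (Q)ᵀ) * S + L * (-Bᵀ) * ((L * H₁ - S * B) * I + L * Bᵀ * S)))).toBlocks₁₁ + G₂ := by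
  obtain ⟨hLI, hΓt, hSt⟩ := minOpL_eq_transpose H₀ (fromRows Q₁₀ τ₁) hH₀
  rw [hL, hI] at hLI
  rw [hΓ] at hΓt
  rw [hS] at hSt
  exact ⟨coarseJet₀_transpose hSt hG₀, coarseJet₁_transpose I B hLI hSt hH₁ hG₁, coarseJet₂_transpose I B Q hLI hΓt hSt hH₁ hH₂ hG₂⟩

end Namings

end Summit.QuantumFields.BalabanUV.Beta.FP.GradedCoarseParity

end
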